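import Summits.Ventures.PercRepro.RankLevelSetRuleQUntruncated

/-!
# PercRepro — (R̂) FOR EVERY MEMBER WITH A SMALL FLAT PART, `k·#P ≤ q + k`, OF EVERY CELL FAMILY `k ≥ 2`
(p4, gen 22; C-044; paper proofs/P4-CELL-THREE.md §11)

`rhat_ge_phiK_of_small_flat (q k m) (2 ≤ k) (k − 1 ≤ q − m) (m ≤ q) (k·m ≤ q + k) : phiK (q + k) q ≤ rhat q k m` and
the matroid form `ruleQRecv_ge_of_flatPart_small`: Rule Q pays `Φ(q+k, q)` to every member of the cell `(q+k, q)` whose flat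
part `P` satisfies `k·#P ≤ q + k` (i.e. `#P ≤ (q + k)/k`, which also puts the member in the untruncated regime once
`q ≥ k + 2`), at the tight layer of every finite matroid, for EVERY `k ≥ 2`.  This is the first positive statement of (R̂)
uniform in `k` on a regime of POSITIVE DENSITY in `#P` (`#P ≤ q/k + 1`), beside the cells `k ≤ 4` (every `#P`) and the slices
`#P ∈ {0, 1, 2}`.

THE PROOF is a termwise pairing in the exact form `rhat_sub_phiK_eq` (RankLevelSetRuleQUntruncated): the `i = 0` row
`Σ_{0<J<k} C(m,J)·A(J)` is paid, term by term, by the `i = k − 1` term `C(u+k, k−1)·C(m, J)·A(J + k − 1)` of the diagonal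
`J + k − 1` (`u = q − m`, `A(J) = 1/C(q+J, J)`), i.e. by `C(q+J+k−1, J+k−1) ≤ C(u+k, k−1)·C(q+J, J)` (`pairing_choose`).
Writing both binomials as products (`choose_add_mul_prod`: `C(a+r, b+r)·Π(b+1+i) = C(a, b)·Π(a+1+i)`) this is the product of
the `k − 1` factor inequalities `(q + J + i)·i ≤ (u + 1 + i)·(J + i)`, `1 ≤ i ≤ k − 1`, each equivalent to
`i·(m − 1) ≤ J·(u + 1)` — true for every `J ≥ 1` exactly when `(k − 1)(m − 1) ≤ u + 1`, i.e. `k·m ≤ q + k`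
(`pairing_factor`).  The remaining diagonals and the remaining terms of each `N_J` are dropped (they are non-negative).
The regime is sharp for THIS pairing (at `k = 2` the pairing is `2(q + 2 − m) ≥ q + 2` exactly) but not for (R̂): the full
diagonals pay the row on a wider regime (numerically `#P ≲ (k−1)q/k`; paper §10.3, §11), and (R̂) itself holds on the whole
untruncated regime in every evaluated case (night-1 g16, INBOX 13040).  Axioms: standard.
-/

namespace PercRepro

open Finset

/-- `C(a+r, b+r)·Π_{i<r}(b+1+i) = C(a, b)·Π_{i<r}(a+1+i)` (the shifted binomial as a product ratio, in `ℕ`). -/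
lemma choose_add_mul_prod (a b r : ℕ) :
    (a + r).choose (b + r) * ∏ i ∈ range r, (b + 1 + i) = a.choose b * ∏ i ∈ range r, (a + 1 + i) := by
  induction r with
  | zero => simp
  | succ r ih =>
    rw [Finset.prod_range_succ, Finset.prod_range_succ, show a + (r + 1) = a + r + 1 by ring,
      show b + (r + 1) = b + r + 1 by ring]
    have h := Nat.add_one_mul_choose_eq (a + r) (b + r)
    calc (a + r + 1).choose (b + r + 1) * ((∏ i ∈ range r, (b + 1 + i)) * (b + 1 + r))
        = ((a + r + 1).choose (b + r + 1) * (b + r + 1)) * ∏ i ∈ range r, (b + 1 + i) := by ring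
      _ = ((a + r + 1) * (a + r).choose (b + r)) * ∏ i ∈ range r, (b + 1 + i) := by rw [h]
      _ = (a + r + 1) * ((a + r).choose (b + r) * ∏ i ∈ range r, (b + 1 + i)) := by ring
      _ = (a + r + 1) * (a.choose b * ∏ i ∈ range r, (a + 1 + i)) := by rw [ih]
      _ = a.choose b * ((∏ i ∈ range r, (a + 1 + i)) * (a + 1 + r)) := by ring

/-- One factor of the pairing: `(u + m + J + (i+1))·(i+1) ≤ (u + 1 + (i+1))·(J + (i+1))` whenever `J ≥ 1`,
`i + 2 ≤ k` and `k·m ≤ u + m + k` (the small-flat hypothesis). -/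
lemma pairing_factor (u m J i k : ℕ) (hJ : 1 ≤ J) (hi : i + 2 ≤ k) (hkm : k * m ≤ u + m + k) :
    (u + m + J + (i + 1)) * (i + 1) ≤ (u + 1 + (i + 1)) * (J + (i + 1)) := by
  rcases Nat.eq_zero_or_pos m with hm | hm
  · subst hm; nlinarith
  · obtain ⟨m', rfl⟩ : ∃ m', m = m' + 1 := ⟨m - 1, by omega⟩
    obtain ⟨d, rfl⟩ : ∃ d, k = i + 2 + d := ⟨k - (i + 2), by omega⟩
    have h1 : (i + 1) * m' ≤ u + 1 := by nlinarith
    nlinarith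

/-- The termwise pairing inequality in `ℕ`: `C(q + J + k, J + k) ≤ C(q + k − m, k − 1)·C(q + J + 1, J + 1)` for `q = u + m`,
`1 ≤ k`, under the small-flat hypothesis. -/
lemma pairing_choose (u m J k : ℕ) (hk : 1 ≤ k) (hkm : k * m ≤ u + m + k) :
    (u + m + (J + 1) + (k - 1)).choose (J + 1 + (k - 1))
      ≤ (u + 1 + (k - 1)).choose (k - 1) * (u + m + (J + 1)).choose (J + 1) := by
  obtain ⟨r, rfl⟩ : ∃ r, k = r + 1 := ⟨k - 1, by omega⟩
  rw [Nat.add_sub_cancel]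
  have hA := choose_add_mul_prod (u + m + (J + 1)) (J + 1) r
  have hB := choose_add_mul_prod (u + 1) 0 r
  rw [Nat.choose_zero_right, one_mul, zero_add] at hB
  have hprod : (∏ i ∈ range r, (u + m + (J + 1) + 1 + i)) * ∏ i ∈ range r, (1 + i)
      ≤ (∏ i ∈ range r, (u + 1 + 1 + i)) * ∏ i ∈ range r, (J + 1 + 1 + i) := by
    rw [← Finset.prod_mul_distrib, ← Finset.prod_mul_distrib]
    refine Finset.prod_le_prod' (fun i hi => ?_)
    rw [Finset.mem_range] at hi
    have := pairing_factor u m (J + 1) i (r + 1) (by omega) (by omega) hkm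
    calc (u + m + (J + 1) + 1 + i) * (1 + i) = (u + m + (J + 1) + (i + 1)) * (i + 1) := by ring
      _ ≤ (u + 1 + (i + 1)) * (J + 1 + (i + 1)) := this
      _ = (u + 1 + 1 + i) * (J + 1 + 1 + i) := by ring
  have hpos : 0 < (∏ i ∈ range r, (J + 1 + 1 + i)) * ∏ i ∈ range r, (1 + i) := by positivity
  refine le_of_mul_le_mul_right ?_ hpos
  calc (u + m + (J + 1) + r).choose (J + 1 + r) * ((∏ i ∈ range r, (J + 1 + 1 + i)) * ∏ i ∈ range r, (1 + i))
      = ((u + m + (J + 1) + r).choose (J + 1 + r) * ∏ i ∈ range r, (J + 1 + 1 + i)) * ∏ i ∈ range r, (1 + i) := by ring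
    _ = ((u + m + (J + 1)).choose (J + 1) * ∏ i ∈ range r, (u + m + (J + 1) + 1 + i)) * ∏ i ∈ range r, (1 + i) := by
        rw [hA]
    _ = (u + m + (J + 1)).choose (J + 1) * ((∏ i ∈ range r, (u + m + (J + 1) + 1 + i)) * ∏ i ∈ range r, (1 + i)) := by
        ring
    _ ≤ (u + m + (J + 1)).choose (J + 1) * ((∏ i ∈ range r, (u + 1 + 1 + i)) * ∏ i ∈ range r, (J + 1 + 1 + i)) :=
        Nat.mul_le_mul_left _ hprod
    _ = (u + m + (J + 1)).choose (J + 1) * (((u + 1 + r).choose r * ∏ i ∈ range r, (1 + i)) * ∏ i ∈ range r, (J + 1 + 1 + i)) := by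
        rw [hB]
    _ = (u + 1 + r).choose r * (u + m + (J + 1)).choose (J + 1) * ((∏ i ∈ range r, (J + 1 + 1 + i)) * ∏ i ∈ range r, (1 + i)) := by
        ring


/-- The termwise pairing in `ℚ`: the `i = 0` term `C(m, J+1)·A(J+1)` is paid by the `i = k − 1` term of the diagonal
`J + k` (`A(J) = 1/C(q+J, J)`, `q = u + m`). -/
lemma pair_term (u m k J : ℕ) (hk : 1 ≤ k) (hkm : k * m ≤ u + m + k) :
    (m.choose (J + 1) : ℚ) * (1 / ((u + m + (J + 1)).choose (J + 1) : ℚ))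
      ≤ (1 / ((u + m + (k + J)).choose (k + J) : ℚ)) * (((u + k).choose (k - 1) : ℚ) * (m.choose (J + 1) : ℚ)) := by
  have h := pairing_choose u m J k hk hkm
  rw [show u + m + (J + 1) + (k - 1) = u + m + (k + J) by omega, show J + 1 + (k - 1) = k + J by omega,
    show u + 1 + (k - 1) = u + k by omega] at h
  have hX : (0 : ℚ) < ((u + m + (J + 1)).choose (J + 1) : ℚ) := by exact_mod_cast Nat.choose_pos (by omega)
  have hY : (0 : ℚ) < ((u + m + (k + J)).choose (k + J) : ℚ) := by exact_mod_cast Nat.choose_pos (by omega)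
  have key : (1 : ℚ) / ((u + m + (J + 1)).choose (J + 1) : ℚ)
      ≤ ((u + k).choose (k - 1) : ℚ) / ((u + m + (k + J)).choose (k + J) : ℚ) := by
    rw [div_le_div_iff₀ hX hY, one_mul]
    exact_mod_cast h
  calc (m.choose (J + 1) : ℚ) * (1 / ((u + m + (J + 1)).choose (J + 1) : ℚ))
      ≤ (m.choose (J + 1) : ℚ) * (((u + k).choose (k - 1) : ℚ) / ((u + m + (k + J)).choose (k + J) : ℚ)) :=
        mul_le_mul_of_nonneg_left key (by positivity)
    _ = (1 / ((u + m + (k + J)).choose (k + J) : ℚ)) * (((u + k).choose (k - 1) : ℚ) * (m.choose (J + 1) : ℚ)) := by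
        ring

/-- **(R̂) FOR EVERY MEMBER WITH A SMALL FLAT PART, EVERY `k ≥ 2`**: if `k·#P ≤ q + k` (and `#P ≤ q − k + 1`, the
untruncated regime) then `Φ(q+k, q) ≤ R̂(q, k, #P)`.  Proof: in the exact form `rhat_sub_phiK_eq`, the `i = 0` row
`Σ_{0<J<k} C(m,J)/C(q+J,J)` is paid termwise by the `i = k − 1` terms of the diagonals `J + k − 1` (`pair_term`, a product
of `k − 1` factor inequalities `(q+J+i)·i ≤ (u+1+i)(J+i)`, each equivalent to `i(m−1) ≤ J(u+1)`). -/
theorem rhat_ge_phiK_of_small_flat (q k m : ℕ) (hk : 2 ≤ k) (hu : k - 1 ≤ q - m) (hm : m ≤ q)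
    (hkm : k * m ≤ q + k) : phiK (q + k) q ≤ rhat q k m := by
  rw [rhat_ge_phiK_iff_untrunc q k m (by omega) hu hm]
  obtain ⟨u, rfl⟩ : ∃ u, q = u + m := ⟨q - m, by omega⟩
  have hkm' : k * m ≤ u + m + k := hkm
  -- the i = k − 1 term of every diagonal J' ≥ k
  have hN : ∀ J' ∈ Ico k (k + m),
      (1 / ((u + m + J').choose J' : ℚ)) * (((u + k).choose (k - 1) : ℚ) * (m.choose (J' - (k - 1)) : ℚ))
        ≤ (1 / ((u + m + J').choose J' : ℚ)) * ∑ i ∈ Ioo 0 k,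
            (if i ≤ J' ∧ J' - i ≤ m then ((u + m + k - m).choose i : ℚ) * (m.choose (J' - i) : ℚ) else 0) := by
    intro J' hJ'
    rw [Finset.mem_Ico] at hJ'
    refine mul_le_mul_of_nonneg_left ?_ (by positivity)
    have hmem : k - 1 ∈ Ioo 0 k := by rw [Finset.mem_Ioo]; omega
    refine le_trans ?_ (Finset.single_le_sum (f := fun i =>
      (if i ≤ J' ∧ J' - i ≤ m then ((u + m + k - m).choose i : ℚ) * (m.choose (J' - i) : ℚ) else 0))
      (fun i _ => by split_ifs <;> positivity) hmem)
    rw [if_pos ⟨by omega, by omega⟩, show u + m + k - m = u + k by omega]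
  -- the positive side, lower-bounded and re-indexed: J' = k + J, J < m
  have hpos : ∑ J ∈ range m, (1 / ((u + m + (k + J)).choose (k + J) : ℚ))
        * (((u + k).choose (k - 1) : ℚ) * (m.choose (J + 1) : ℚ))
      ≤ ∑ J' ∈ Ico k (k + m), (1 / ((u + m + J').choose J' : ℚ)) * ∑ i ∈ Ioo 0 k,
            (if i ≤ J' ∧ J' - i ≤ m then ((u + m + k - m).choose i : ℚ) * (m.choose (J' - i) : ℚ) else 0) := by
    refine le_trans (le_of_eq ?_) (Finset.sum_le_sum hN)
    rw [Finset.sum_Ico_eq_sum_range, show k + m - k = m by omega]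
    refine Finset.sum_congr rfl (fun J _ => ?_)
    rw [show k + J - (k - 1) = J + 1 by omega]
  -- the negative side re-indexed: J = J₀ + 1, J₀ < k − 1
  rw [sum_Ioo_nat, show k - (0 + 1) = k - 1 by omega]
  refine le_trans ?_ hpos
  -- termwise f ≤ g, f and g vanish from J ≥ m on
  set f : ℕ → ℚ := fun J => (m.choose (0 + 1 + J) : ℚ) * (1 / ((u + m + (0 + 1 + J)).choose (0 + 1 + J) : ℚ)) with hf
  set g : ℕ → ℚ := fun J => (1 / ((u + m + (k + J)).choose (k + J) : ℚ))
        * (((u + k).choose (k - 1) : ℚ) * (m.choose (J + 1) : ℚ)) with hg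
  have hfg : ∀ J, f J ≤ g J := by
    intro J
    simp only [hf, hg, show 0 + 1 + J = J + 1 by ring]
    exact pair_term u m k J (by omega) hkm'
  have hg0 : ∀ J, m ≤ J → g J = 0 := by
    intro J hJ
    simp only [hg]
    rw [Nat.choose_eq_zero_of_lt (by omega : m < J + 1)]
    simp
  have hgnn : ∀ J, 0 ≤ g J := by
    intro J
    simp only [hg]
    positivity
  calc ∑ J ∈ range (k - 1), f J ≤ ∑ J ∈ range (k - 1), g J := Finset.sum_le_sum (fun J _ => hfg J)
    _ ≤ ∑ J ∈ range (k - 1 + m), g J :=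
        Finset.sum_le_sum_of_subset_of_nonneg
          (fun x hx => by rw [Finset.mem_range] at hx ⊢; omega) (fun J _ _ => hgnn J)
    _ = ∑ J ∈ range m, g J := by
        rw [← Finset.sum_range_add_sum_Ico _ (show m ≤ k - 1 + m by omega)]
        rw [Finset.sum_eq_zero (fun J hJ => hg0 J (Finset.mem_Ico.1 hJ).1), add_zero]

variable {α : Type} (M : Matroid α) [M.Finite]

/-- **Rule Q pays `Φ(q+k, q)` to every member with a small flat part** — `k·#P ≤ q + k` and `#P ≤ q − k + 1` — of every
cell `(q+k, q)` at the tight layer of every finite matroid, every `k ≥ 2`. -/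
theorem ruleQRecv_ge_of_flatPart_small {q k : ℕ} (hk : 2 ≤ k) (hE : M.E.ncard = (q + k) + q)
    {Z : Set α} (hZ : Z ∈ cellMembers M (q + k) q) (hu : k - 1 ≤ q - (flatPart M Z).ncard)
    (hkm : k * (flatPart M Z).ncard ≤ q + k) :
    phiK (q + k) q ≤ ruleQRecv M (q + k) q Z := by
  refine le_trans ?_ (rhat_le_ruleQRecv M hE hZ)
  have hm : (flatPart M Z).ncard ≤ q :=
    (Nat.lt_of_sub_pos (lt_of_lt_of_le (show 0 < k - 1 by omega) hu)).le
  exact rhat_ge_phiK_of_small_flat q k _ hk hu hm hkm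

end PercRepro
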